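import Summits.BirchSwinnertonDyer.BirchSwinnertonDyer.Theorems.AdditiveBranchIMCGordTwoRankZeroOffCaseOnePerPlaceE0GZTransport
import Summits.BirchSwinnertonDyer.BirchSwinnertonDyer.Theorems.ClassRecordThreeEulerHalvesAtThreeShimuraE0ReceptacleOfLabelB6
import Summits.BirchSwinnertonDyer.BirchSwinnertonDyer.Theorems.PrintCFramBottomClassIndexLawFiveLeHeegnerFamilySplitting
import Literature.NumberTheory.EllipticCurves.CMPointsIdentityComponentLabel
import HarnessLib
import Literature.NumberTheory.EllipticCurves.CMPointsOfConductorIdentityComponent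

/-!
# Crux `AdditiveBranchIMC.GordTwoRankZeroOffCaseOne` (stmt-BirchSwinnertonDyer-19357), line `genus-stringent-road-k`,
# stub S3 `stub_perPlaceE0GZ` — THE LOCAL STATEMENT `GenusStringentRoadK.PerPlaceE0GZ`, CONDITIONAL on ONE OPEN
# summit-side local hypothesis (print-ADJACENT, NOT a Literature fact): CM points of conductor `m` on `X₀(N)` land in `E⁰`
# up to rational torsion at the places over a prime `r ∥ N`, `r ∤ m·d_K`, under the GENERALIZED Heegner condition
# `4N ∣ β² − d_K` — printed (Gross–Zagier 1986 III (3.1) / Gross 1991 p. 245 / Jetchev 2008 Cor. 3.2) ONLY under the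
# classical Heegner hypothesis (helper 2/2, `--supports stmt-BirchSwinnertonDyer-19357`; LEAD
# `cruxlead-stmt-BirchSwinnertonDyer-19357` g22, stub worker S3; v2 = ref-2 NIT n250, director-bsd (987)(d) branch 2)

HONEST FRAMING. Nothing about BSD is proved; the crux item stays OPEN; the registered stub `stub_perPlaceE0GZ : PerPlaceE0GZ`
(skeleton `Cruxes/GordTwoRankZeroOffCaseOne/Lines/genus_stringent_road_k.lean`) is NOT closed by this file: its statement
rests on a geometric input the tree does not prove and cannot state as a theorem (integral models of `X₀(N)` over `ℤ_r` —
Deligne–Rapoport / Katz–Mazur — and Néron models of `J₀(N)` are not in the tree), and which is IN PRINT ONLY under the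
classical Heegner hypothesis, not under the generalized condition the line needs. This file
(i) records that input ONCE as an OPEN SUMMIT-SIDE LOCAL HYPOTHESIS `GenusStringentRoadK.CMPointOfConductorMemE0GeneralHeegner`
(`@[conjecture] def … : Prop` in THIS file, §1 — the tree's tag for an unproven statement under `Summits/`; not cite-tagged, NOT a
Literature fact: a DEBT of line A, never folded into
`PrintedFactsR0` or any cite conjunction; in the vocabulary of `Literature/NumberTheory/EllipticCurves/HeegnerPointsIdentityComponent`
and `…/CMPointsIdentityComponentLabel`: `MemE0ModRatTorsion`, `heegnerPointComplexOfConductor`, `ringClassField`), and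
(ii) PROVES `perPlaceE0GZ_of_memE0GeneralHeegner : GenusStringentRoadK.CMPointOfConductorMemE0GeneralHeegner → <body of PerPlaceE0GZ>` — the
skeleton's binder text verbatim (same `open`s for name resolution) except that the receptacle `X11b.E0Receptacle` is spelled by
its full name `Summit.BirchSwinnertonDyer.Rank1Residual.X11b.E0Receptacle` (the same constant; the statement is syntactically the
skeleton's `PerPlaceE0GZ` after name resolution, so `stub_perPlaceE0GZ` unfolds to it definitionally). After this file the stub's
wording of record is «closed modulo ONE OPEN summit-side local hypothesis (print-adjacent)»; the line-A debt ledger of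
stmt-BirchSwinnertonDyer-19357 reads «cited prints −1, OPEN summit-side local hypotheses +1»; 19357 stays OPEN.
v1 → v2 (this file, ADDITIVE — Theorems decls are append-only: the gate refuses to mutate or drop v1's closer,
`theorems.append-only`): §1 ADDS the summit-side OPEN hypothesis (body byte-identical to the v1 transcription that the gate relocated
to `Literature.NumberTheory.EllipticCurves.cmPointOfConductor_memE0ModRatTorsion_of_exactlyDivides` — a GENERAL form typed beyond
its print, ref-2 NIT n250); §2 ADDS the closer `perPlaceE0GZ_of_memE0GeneralHeegner` from it — conclusion (binder text) and proof
script identical to v1's closer, hypothesis re-pointed; §3 KEEPS v1's closer `perPlaceE0GZ_of_memE0` (hypothesis = that Literature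
decl) byte-identical as LEGACY with no new use — it, and the import of `…CMPointsOfConductorIdentityComponent`, are to be dropped by
a refactor act, after which the Literature decl can be re-filed print-as-typed (binder `SatisfiesHeegnerHypothesis N K`) or retired
without a consumer breaking. The line reads S3 through §2 only.

WHY A SUMMIT-SIDE OPEN HYPOTHESIS (and neither `Gross1991_heegnerPoint_sub_ratTorsion_mem_E0{,_imageFree}` nor a Literature
fact). The tree's two facts are keyed to the classical Heegner hypothesis `SatisfiesHeegnerHypothesis N K` (every prime of `N`
splits in `K`), to `d_K ∉ {−3, −4}`, to square-free KOLYVAGIN conductors and to a `KolyvaginHeegnerData` datum (generators `σ_ℓ`,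
a transversal `S`), and they read `E⁰` on a globally minimal model carrying the parametrisation datum. `PerPlaceE0GZ` quantifies
over `K` with only `4N ∣ β² − d_K` (ramified primes `q ∣ gcd(N, d_K)` allowed — the genus ∕ Cai–Shu–Tian frame of the k = 1 rows,
on which `SatisfiesHeegnerHypothesis N K` is FALSE by design), over every conductor `m ≥ 1` prime to `N`, over a bare point
`y ∈ E′(K[m])` over the CM point, and over an ARBITRARY model `E′/ℚ`. The printed proof ([GZ86 III §3]: at a prime `r ∣ N` split
in `K` a CM point of conductor prime to `r` has ordinary reduction and meets the component `𝓕_{n,0} ∋ ∞` or `𝓕_{0,n} ∋ 0` of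
`X₀(N) ⊗ 𝔽̄_r`; `(x) − (cusp) ∈ J⁰`; `φ_*((0) − (∞)) ∈ E(ℚ)_tors` by Manin–Drinfeld; Néron functoriality of `φ_*`) is LOCAL
at `r` and uses neither `(d_K, N) = 1` at the other primes nor the Kolyvagin conditions on `m` (Jetchev 2008 Prop. 3.1 is stated
for «any conductor `c` prime to char `v`»); but the sentence under `4N ∣ β² − d_K` with `(d_K, N) ≠ 1` is NOT PRINTED as such in
Gross–Zagier 1986, Gross 1991 or Jetchev 2008 (all three state the classical hypothesis up front: GZ86 I §3 p. 227; Gross 1991 §1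
p. 235; Jetchev 2008 §1.1). A published fact must be print-as-typed, so the generalized form cannot be a Literature decl (ref-2
NIT n250); it is declared HERE, summit-side, as an OPEN local hypothesis of the line — a debt, not a theorem (typed ≠ proved ≠
endorsed). The print-as-typed sentence (extra binder `SatisfiesHeegnerHypothesis N K`) is the Literature side's business; §2 does
not use the Literature decl (only the legacy closer of §3 does, pending the refactor act).

PROOF OF `perPlaceE0GZ_of_memE0GeneralHeegner` (kernel-checked; ~60 lines). `E′` arbitrary: take a global minimal model `C • E′`
(`hasGlobalMinimalModel_rat_holds`, Néron ∕ Silverman VIII.8.3). `r` splits in `K`: `d_K · 1² = β² − 4(N k)` with `r ∣ N k`,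
`r ∤ β` (else `r ∣ d_K`), tree `PrintCFram.HeegnerFamily.ncard_primesOver_eq_two_of_dvd_of_not_dvd` (Cox 5.16). Hence
`((C • E′) ⊗ K) ⊗ K_v` is minimal at `v ∋ r` (`ShimuraKolyvaginOfImage.natCast_mem_and_isMinimal_of_split`, `e = f = 1`).
The hypothesis gives `C • y − t ∈ E₀(K[m])_w` at every `w ∋ r`, `t ∈ (C • E′)(ℚ)_tors`; `#E′(ℚ)_tors • t = O` (the order of `t`
is the order of `C⁻¹ • t ∈ E′(ℚ)`, which divides `#E′(ℚ)_tors`, tree `addOrderOf_dvd_torsionOrder`), so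
`#E′(ℚ)_tors • (C • y) ∈ E₀(K[m])_w` (`MemE0ModRatTorsion.nsmul_of_forall_torsion`); the presented-model transport
`GenusStringentRoadK.pointsMap_map_mem_E0Receptacle_of_forall_place_smul` (helper 1/2, Silverman VII.1.3 (b)) along
`e : K[m] → K̄` with `N := r` lands `#E′(ℚ)_tors • e(y)` in `X11b.E0Receptacle (E′ ⊗ K) v`.

References: [cite: GrossZagier1986Heegner, III (3.1) Proposition, p. 256] [cite: GrossLMS1991, §6, proof of Prop. 6.2 (1), p. 245]
[cite: Jetchev2008, Prop. 3.1, Cor. 3.2 (p. 816)] [cite: SilvermanAEC2009, VII.1 Prop. 1.3 (b), VII.2 Prop. 2.1, VIII.8.3]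
[cite: Cox2013, Prop. 5.16].
presearch: `lit search --hybrid "Heegner point reduction bad prime identity component Néron model X_0(N) Deligne Rapoport cusp"` →
[corpus: book:editornd-l-functions-arithmetic p0222] (Gross 1991 p. 245, `(D, N) = 1`); `lit vsearch «CM point of conductor prime to q
on X0(N) reduces to the component of a cusp …»` → the same + noise; [corpus: paper:arxiv-math_0703431 p0008] Jetchev 2008 Prop. 3.1 /
Cor. 3.2 (any conductor prime to char `v`; classical Heegner hypothesis); [corpus: paper:doi-10-1017-fms-2019-9] Kriz–Li 2019
(classical hypothesis only); `lit galaxy search "reduce to the same irreducible component|component containing the cusp|Heegner points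
of conductor" --star all` → Yuan–Zhang–Zhang (no page), Gross 1991; Cai–Shu–Tian 2014 ∕ Tian 2014 not held → no printed source for the
generalized-Heegner reading (hence an OPEN summit-side hypothesis, not a cited fact); `lean search 'CMPointOfConductorMemE0GeneralHeegner'`
→ none (name free). Axioms of `perPlaceE0GZ_of_memE0GeneralHeegner`: `propext`, `Classical.choice`, `Quot.sound`.
-/

set_option autoImplicit false
-- D-0017: single-problem summit, so `Summit.BirchSwinnertonDyer.BirchSwinnertonDyer.…` repeats a namespace BY DESIGN.
set_option linter.dupNamespace false

noncomputable section

open scoped Classical Pointwise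

namespace Summit.BirchSwinnertonDyer.BirchSwinnertonDyer.Theorems.GenusStringentRoadK

-- The `open`s serve name resolution in §2's binder text (the skeleton's, verbatim); §1's hypothesis is written with FULLY
-- QUALIFIED names, and the Summits-side receptacle in §2 is spelled by its full name
-- (`Summit.BirchSwinnertonDyer.Rank1Residual.X11b.E0Receptacle` = the skeleton's `X11b.E0Receptacle`, same constant).
open WeierstrassCurve
open NumberField
open IsDedekindDomain
open Literature.NumberTheory.EllipticCurves
open Literature.NumberTheory.EllipticCurves.ModularForms

/-! ## §1 The local input, named once as an OPEN summit-side hypothesis (nothing is asserted) -/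

/-- **OPEN summit-side local hypothesis (print-ADJACENT), NOT a Literature fact.** CM points of conductor `m` on `X₀(N)`
lie in `E⁰ + E(ℚ)_tors` at every place `w ∣ r` of `K[m]`, for a prime `r ∥ N`, `r ∤ m·d_K`, under the GENERALIZED Heegner
condition `4N ∣ β² − d_K` (ramification of `K` allowed at the OTHER primes of `N`). IN PRINT ONLY under the classical Heegner
hypothesis (all primes of `N` split in `K`): Gross–Zagier 1986 III (3.1) Proposition p. 256; Gross 1991 §6 p. 245 (proof of
Prop. 6.2 (1)); Jetchev 2008 Prop. 3.1 ∕ Cor. 3.2 p. 816 — the print-as-typed sentence carries the extra binder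
`SatisfiesHeegnerHypothesis N K` and is the Literature side's business (the decl
`Literature.NumberTheory.EllipticCurves.cmPointOfConductor_memE0ModRatTorsion_of_exactlyDivides`, v1's relocated GENERAL-form
transcription consumed only by the legacy closer of §3, is to be re-filed in that printed form or retired — ref-2 NIT n250).
The printed proof is local at `r` (Deligne–Rapoport ∕ Katz–Mazur fibre of `X₀(N)` at `r ∥ N`, ordinary reduction of the CM point
of conductor prime to `r` into the component of a cusp, Manin–Drinfeld for `φ_*((0) − (∞)) ∈ E(ℚ)_tors`, Néron functoriality of
`φ_*`) — XL input absent from the tree (no integral models of `X₀(N)`, no Néron models of `J₀(N)`); that it goes through verbatim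
under the generalized condition is this line's EXPECTATION, not a printed statement. A DEBT of line `genus-stringent-road-k`
(stub S3's wording of record: «closed modulo ONE OPEN summit-side local hypothesis (print-adjacent)»), never folded into
`PrintedFactsR0` or any cite conjunction. Typed ≠ proved ≠ endorsed; director-bsd (987)(d); ref-2 NIT n250.
Transcription (tree vocabulary, as `MemE0ModRatTorsion` ∕ `Gross1991_heegnerPoint_sub_ratTorsion_mem_E0_imageFree`): `E′/ℚ` ANY
model (`[E′.IsElliptic]`) with a modular parametrisation datum `Dt` of level `N` (`φ(∞) = O`); `K` imaginary quadratic,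
`ι : K → ℂ`, an orientation `β` with `4N ∣ β² − d_K`; a conductor `m ≥ 1` prime to `N`; `y ∈ E′(K[m])` mapping to the CM point
`φ(x_m)` of conductor `m` (`heegnerPointComplexOfConductor`; the `K[m]`-rational point is DATA); a prime `r ∣ N`, `r² ∤ N`,
`r ∤ d_K`; `E⁰` read as nonsingular reduction on a presented GLOBALLY MINIMAL model `C • E′` (`C` a change of variables over
`ℚ`), the point transported by `VariableChange.pointEquivBaseChange`; the group law on `E′(K[m])` read with an ARBITRARY
`DecidableEq K[m]` (inner instance binder; all instances agree). Conclusion: at every finite place `w` of `K[m]` with `r ∈ w`,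
`MemE0ModRatTorsion (C • E′) K[m] w (C • y)`, i.e. `C • y − t ∈ E₀(K[m])_w` for some torsion point `t ∈ (C • E′)(ℚ)`. -/
@[conjecture] def CMPointOfConductorMemE0GeneralHeegner : Prop :=
  ∀ {N : ℕ} [NeZero N] {E' : WeierstrassCurve ℚ} [E'.IsElliptic]
    (Dt : Literature.NumberTheory.EllipticCurves.ModularForms.ModularParametrizationData E' N)
    {K : Type} [Field K] [NumberField K]
    (_hK : Literature.NumberTheory.EllipticCurves.IsImaginaryQuadratic K) (ι : K →+* ℂ) {β : ℤ}
    (_hβ : (4 * (N : ℤ)) ∣ β ^ 2 - NumberField.discr K) {m : ℕ} (_hm : m ≠ 0) (_hmN : Nat.Coprime m N)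
    [NumberField (Literature.NumberTheory.EllipticCurves.ringClassField K ι m)]
    [DecidableEq (Literature.NumberTheory.EllipticCurves.ringClassField K ι m)]
    (y : (E'.baseChange (Literature.NumberTheory.EllipticCurves.ringClassField K ι m)).toAffine.Point)
    (_hy : WeierstrassCurve.Affine.Point.map
        (Literature.NumberTheory.EllipticCurves.ringClassField K ι m).subtype.toRatAlgHom y =
      Literature.NumberTheory.EllipticCurves.ModularForms.heegnerPointComplexOfConductor Dt
        (NumberField.discr K) β m)
    {r : ℕ} (_hr : r.Prime) (_hrN : r ∣ N) (_hr2 : ¬ r ^ 2 ∣ N) (_hrD : ¬ (r : ℤ) ∣ NumberField.discr K)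
    (C : WeierstrassCurve.VariableChange ℚ) [(C • E').IsGloballyMinimal]
    (w : IsDedekindDomain.HeightOneSpectrum
      (NumberField.RingOfIntegers (Literature.NumberTheory.EllipticCurves.ringClassField K ι m))),
    ((r : ℕ) : NumberField.RingOfIntegers (Literature.NumberTheory.EllipticCurves.ringClassField K ι m)) ∈
        w.asIdeal →
      Literature.NumberTheory.EllipticCurves.MemE0ModRatTorsion (C • E')
        (Literature.NumberTheory.EllipticCurves.ringClassField K ι m) w
        (WeierstrassCurve.VariableChange.pointEquivBaseChange E' C
          (Literature.NumberTheory.EllipticCurves.ringClassField K ι m) y)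

/-! ## §2 The stub's statement from the hypothesis -/

/-- **`PerPlaceE0GZ` from the OPEN local hypothesis** — the body of `GenusStringentRoadK.PerPlaceE0GZ` (line
`genus-stringent-road-k`, stub S3) VERBATIM up to spelling the receptacle by its full name, conditional on
`GenusStringentRoadK.CMPointOfConductorMemE0GeneralHeegner` (§1; OPEN, print-adjacent — not a Literature fact):
for `E′/ℚ` elliptic (any model) with a modular parametrisation datum `Dt` of level `N`, `K` imaginary quadratic with
`4N ∣ β² − d_K`, `m ≥ 1` prime to `N`, `y ∈ E′(K[m])` over the CM point of conductor `m`, a `K`-embedding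
`e : K[m] → K̄`, a prime `r ∥ N` with `r ∤ d_K`, and a place `v ∋ r` of `K`:
`#E′(ℚ)_tors • e(y)_v ∈ E⁰(K̄_v) = X11b.E0Receptacle (E′ ⊗ K) v`. Proof: global minimal model `C • E′`; `r` splits in
`K` (`d_K = β² − 4Nk`, `r ∤ β`); `((C • E′) ⊗ K) ⊗ K_v` minimal; the hypothesis at every `w ∋ r` with the torsion translate
killed by `#E′(ℚ)_tors`; the presented-model transport along `e` with `N := r`.
[cite: GrossZagier1986Heegner, III (3.1) Proposition, p. 256] [cite: GrossLMS1991, §6, proof of Prop. 6.2 (1), p. 245]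
[cite: Jetchev2008, Prop. 3.1, Cor. 3.2 (p. 816)] [cite: SilvermanAEC2009, VII.1 Prop. 1.3 (b), VIII.8.3] -/
theorem perPlaceE0GZ_of_memE0GeneralHeegner (hGZ : GenusStringentRoadK.CMPointOfConductorMemE0GeneralHeegner) :
    ∀ (E' : WeierstrassCurve ℚ) [E'.IsElliptic] (N : ℕ) [NeZero N] (K : Type) [Field K] [NumberField K],
      IsImaginaryQuadratic K →
      ∀ (Dt : ModularParametrizationData E' N) (β : ℤ) (ι : K →+* ℂ) (m : ℕ),
      (4 * (N : ℤ)) ∣ β ^ 2 - NumberField.discr K → m ≠ 0 → Nat.Coprime m N →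
      ∀ (y : (E'.baseChange (ringClassField K ι m)).toAffine.Point),
      Affine.Point.map (ringClassField K ι m).subtype.toRatAlgHom y = heegnerPointComplexOfConductor Dt (NumberField.discr K) β m →
      ∀ (e : ringClassField K ι m →ₐ[K] AlgebraicClosure K) (r : ℕ), r.Prime → r ∣ N → ¬ r ^ 2 ∣ N →
      ¬ (r : ℤ) ∣ NumberField.discr K →
      ∀ v : HeightOneSpectrum (𝓞 K), ((r : ℕ) : 𝓞 K) ∈ v.asIdeal →
        (E'.torsionOrder : ℤ) • pointsMap (E'.baseChange K) (v.adicCompletion K)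
            (Affine.Point.map (W' := E') e.toRingHom.toRatAlgHom y) ∈
          Summit.BirchSwinnertonDyer.Rank1Residual.X11b.E0Receptacle (E'.baseChange K) v := by
  intro E' _ N _ K _ _ hK Dt β ι m hβ hm hmN y hy e r hr hrN hr2 hrD v hrv
  haveI : Fact r.Prime := ⟨hr⟩
  haveI : NumberField (ringClassField K ι m) := numberField_ringClassField hK ι hm
  -- a global minimal model `C • E′` (Néron; Silverman VIII.8.3)
  obtain ⟨C, hC⟩ := hasGlobalMinimalModel_rat_holds E'
  haveI := hC
  -- `r` splits in `K`: `d_K · 1² = β² − 4 (N k)` with `r ∣ N k` and `r ∤ β` (else `r ∣ d_K`)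
  obtain ⟨k, hk⟩ := id hβ
  have hfam : NumberField.discr K * 1 ^ 2 = β ^ 2 - 4 * ((N : ℤ) * k) := by linear_combination -hk
  have hsplit : ((Ideal.span {(r : ℤ)}).primesOver (𝓞 K)).ncard = 2 := by
    refine PrintCFram.HeegnerFamily.ncard_primesOver_eq_two_of_dvd_of_not_dvd hK.1 hfam hr
      (Dvd.dvd.mul_right (Int.natCast_dvd_natCast.mpr hrN) k) fun hrβ ↦ hrD ?_
    have hD : NumberField.discr K = β ^ 2 - 4 * ((N : ℤ) * k) := by linear_combination -hk
    rw [hD]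
    exact dvd_sub (dvd_pow hrβ two_ne_zero)
      (Dvd.dvd.mul_left (Dvd.dvd.mul_right (Int.natCast_dvd_natCast.mpr hrN) k) 4)
  -- `((C • E′) ⊗ K) ⊗ K_v` is minimal (`r` split: `e = f = 1`)
  obtain ⟨-, hmin⟩ :=
    ShimuraKolyvaginOfImage.natCast_mem_and_isMinimal_of_split (C • E') hK r hsplit (dvd_refl r) v hrv
  -- `#E′(ℚ)_tors` kills the rational torsion of the isomorphic model `C • E′`
  have htors : ∀ t : (C • E').toAffine.Point, IsOfFinAddOrder t → E'.torsionOrder • t = 0 := by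
    intro t ht
    apply addOrderOf_dvd_iff_nsmul_eq_zero.mp
    have ht' : IsOfFinAddOrder ((VariableChange.pointEquiv E' C).symm t) :=
      (VariableChange.pointEquiv E' C).symm.toAddMonoidHom.isOfFinAddOrder ht
    have hdvd := addOrderOf_dvd_torsionOrder E' ht'
    rwa [AddEquiv.addOrderOf_eq] at hdvd
  -- the fact at every place `w ∋ r` of `K[m]`, torsion translate killed
  have hE0 : ∀ w : HeightOneSpectrum (𝓞 (ringClassField K ι m)),
      ((r : ℕ) : 𝓞 (ringClassField K ι m)) ∈ w.asIdeal →
      (placeIntModel (C • E') (ringClassField K ι m) w).HasNonsingularReduction (K := ringClassField K ι m)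
        (VariableChange.pointEquivBaseChange E' C (ringClassField K ι m) (E'.torsionOrder • y)) := by
    intro w hw
    rw [map_nsmul]
    exact (hGZ Dt hK ι hβ hm hmN y hy hr hrN hr2 hrD C w hw).nsmul_of_forall_torsion htors
  -- transport along `e : K[m] → K̄ → K̄_v` (helper 1/2), then pull the multiple out of the composite
  -- homomorphism `E′(K[m]) → E′(K̄) → E′(K̄_v)` (read into the type synonyms `geomPoints`, `localPoints`)
  have hmem := pointsMap_map_mem_E0Receptacle_of_forall_place_smul E' C v hmin hrv
    e.toRingHom.toRatAlgHom (E'.torsionOrder • y) hE0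
  have key : ∀ P : (E'.baseChange (ringClassField K ι m)).toAffine.Point,
      pointsMap (E'.baseChange K) (v.adicCompletion K)
          (Affine.Point.map (W' := E') e.toRingHom.toRatAlgHom P) =
        ((pointsMap (E'.baseChange K) (v.adicCompletion K)).comp
          (Affine.Point.map (W' := E') e.toRingHom.toRatAlgHom :
            (E'.baseChange (ringClassField K ι m)).toAffine.Point →+ geomPoints (E'.baseChange K))) P :=
    fun _ ↦ rfl
  rw [key, map_nsmul] at hmem
  rw [key, natCast_zsmul]
  exact hmem

/-! ## §3 v1's closer, kept byte-identical (Theorems decls are append-only): the same conclusion from the Literature decl in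
its pre-n250 general form — LEGACY, no new use; superseded by `perPlaceE0GZ_of_memE0GeneralHeegner` (§2); to be dropped together
with the import by a refactor act when that decl is re-filed print-as-typed -/

/-- **`PerPlaceE0GZ` from the named fact** — the body of `GenusStringentRoadK.PerPlaceE0GZ` (line
`genus-stringent-road-k`, stub S3) VERBATIM up to spelling the receptacle by its full name, conditional on
`cmPointOfConductor_memE0ModRatTorsion_of_exactlyDivides`:
for `E′/ℚ` elliptic (any model) with a modular parametrisation datum `Dt` of level `N`, `K` imaginary quadratic with
`4N ∣ β² − d_K`, `m ≥ 1` prime to `N`, `y ∈ E′(K[m])` over the CM point of conductor `m`, a `K`-embedding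
`e : K[m] → K̄`, a prime `r ∥ N` with `r ∤ d_K`, and a place `v ∋ r` of `K`:
`#E′(ℚ)_tors • e(y)_v ∈ E⁰(K̄_v) = X11b.E0Receptacle (E′ ⊗ K) v`. Proof: global minimal model `C • E′`; `r` splits in
`K` (`d_K = β² − 4Nk`, `r ∤ β`); `((C • E′) ⊗ K) ⊗ K_v` minimal; the fact at every `w ∋ r` with the torsion translate
killed by `#E′(ℚ)_tors`; the presented-model transport along `e` with `N := r`.
[cite: GrossZagier1986Heegner, III (3.1) Proposition, p. 256] [cite: GrossLMS1991, §6, proof of Prop. 6.2 (1), p. 245]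
[cite: Jetchev2008, Prop. 3.1, Cor. 3.2 (p. 816)] [cite: SilvermanAEC2009, VII.1 Prop. 1.3 (b), VIII.8.3] -/
theorem perPlaceE0GZ_of_memE0 (hGZ : Literature.NumberTheory.EllipticCurves.cmPointOfConductor_memE0ModRatTorsion_of_exactlyDivides) :
    ∀ (E' : WeierstrassCurve ℚ) [E'.IsElliptic] (N : ℕ) [NeZero N] (K : Type) [Field K] [NumberField K],
      IsImaginaryQuadratic K →
      ∀ (Dt : ModularParametrizationData E' N) (β : ℤ) (ι : K →+* ℂ) (m : ℕ),
      (4 * (N : ℤ)) ∣ β ^ 2 - NumberField.discr K → m ≠ 0 → Nat.Coprime m N →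
      ∀ (y : (E'.baseChange (ringClassField K ι m)).toAffine.Point),
      Affine.Point.map (ringClassField K ι m).subtype.toRatAlgHom y = heegnerPointComplexOfConductor Dt (NumberField.discr K) β m →
      ∀ (e : ringClassField K ι m →ₐ[K] AlgebraicClosure K) (r : ℕ), r.Prime → r ∣ N → ¬ r ^ 2 ∣ N →
      ¬ (r : ℤ) ∣ NumberField.discr K →
      ∀ v : HeightOneSpectrum (𝓞 K), ((r : ℕ) : 𝓞 K) ∈ v.asIdeal →
        (E'.torsionOrder : ℤ) • pointsMap (E'.baseChange K) (v.adicCompletion K)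
            (Affine.Point.map (W' := E') e.toRingHom.toRatAlgHom y) ∈
          Summit.BirchSwinnertonDyer.Rank1Residual.X11b.E0Receptacle (E'.baseChange K) v := by
  intro E' _ N _ K _ _ hK Dt β ι m hβ hm hmN y hy e r hr hrN hr2 hrD v hrv
  haveI : Fact r.Prime := ⟨hr⟩
  haveI : NumberField (ringClassField K ι m) := numberField_ringClassField hK ι hm
  -- a global minimal model `C • E′` (Néron; Silverman VIII.8.3)
  obtain ⟨C, hC⟩ := hasGlobalMinimalModel_rat_holds E'
  haveI := hC
  -- `r` splits in `K`: `d_K · 1² = β² − 4 (N k)` with `r ∣ N k` and `r ∤ β` (else `r ∣ d_K`)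
  obtain ⟨k, hk⟩ := id hβ
  have hfam : NumberField.discr K * 1 ^ 2 = β ^ 2 - 4 * ((N : ℤ) * k) := by linear_combination -hk
  have hsplit : ((Ideal.span {(r : ℤ)}).primesOver (𝓞 K)).ncard = 2 := by
    refine PrintCFram.HeegnerFamily.ncard_primesOver_eq_two_of_dvd_of_not_dvd hK.1 hfam hr
      (Dvd.dvd.mul_right (Int.natCast_dvd_natCast.mpr hrN) k) fun hrβ ↦ hrD ?_
    have hD : NumberField.discr K = β ^ 2 - 4 * ((N : ℤ) * k) := by linear_combination -hk
    rw [hD]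
    exact dvd_sub (dvd_pow hrβ two_ne_zero)
      (Dvd.dvd.mul_left (Dvd.dvd.mul_right (Int.natCast_dvd_natCast.mpr hrN) k) 4)
  -- `((C • E′) ⊗ K) ⊗ K_v` is minimal (`r` split: `e = f = 1`)
  obtain ⟨-, hmin⟩ :=
    ShimuraKolyvaginOfImage.natCast_mem_and_isMinimal_of_split (C • E') hK r hsplit (dvd_refl r) v hrv
  -- `#E′(ℚ)_tors` kills the rational torsion of the isomorphic model `C • E′`
  have htors : ∀ t : (C • E').toAffine.Point, IsOfFinAddOrder t → E'.torsionOrder • t = 0 := by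
    intro t ht
    apply addOrderOf_dvd_iff_nsmul_eq_zero.mp
    have ht' : IsOfFinAddOrder ((VariableChange.pointEquiv E' C).symm t) :=
      (VariableChange.pointEquiv E' C).symm.toAddMonoidHom.isOfFinAddOrder ht
    have hdvd := addOrderOf_dvd_torsionOrder E' ht'
    rwa [AddEquiv.addOrderOf_eq] at hdvd
  -- the fact at every place `w ∋ r` of `K[m]`, torsion translate killed
  have hE0 : ∀ w : HeightOneSpectrum (𝓞 (ringClassField K ι m)),
      ((r : ℕ) : 𝓞 (ringClassField K ι m)) ∈ w.asIdeal →
      (placeIntModel (C • E') (ringClassField K ι m) w).HasNonsingularReduction (K := ringClassField K ι m)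
        (VariableChange.pointEquivBaseChange E' C (ringClassField K ι m) (E'.torsionOrder • y)) := by
    intro w hw
    rw [map_nsmul]
    exact (hGZ Dt hK ι hβ hm hmN y hy hr hrN hr2 hrD C w hw).nsmul_of_forall_torsion htors
  -- transport along `e : K[m] → K̄ → K̄_v` (helper 1/2), then pull the multiple out of the composite
  -- homomorphism `E′(K[m]) → E′(K̄) → E′(K̄_v)` (read into the type synonyms `geomPoints`, `localPoints`)
  have hmem := pointsMap_map_mem_E0Receptacle_of_forall_place_smul E' C v hmin hrv
    e.toRingHom.toRatAlgHom (E'.torsionOrder • y) hE0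
  have key : ∀ P : (E'.baseChange (ringClassField K ι m)).toAffine.Point,
      pointsMap (E'.baseChange K) (v.adicCompletion K)
          (Affine.Point.map (W' := E') e.toRingHom.toRatAlgHom P) =
        ((pointsMap (E'.baseChange K) (v.adicCompletion K)).comp
          (Affine.Point.map (W' := E') e.toRingHom.toRatAlgHom :
            (E'.baseChange (ringClassField K ι m)).toAffine.Point →+ geomPoints (E'.baseChange K))) P :=
    fun _ ↦ rfl
  rw [key, map_nsmul] at hmem
  rw [key, natCast_zsmul]
  exact hmem

end Summit.BirchSwinnertonDyer.BirchSwinnertonDyer.Theorems.GenusStringentRoadK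

end
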